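import Mathlib.NumberTheory.Multiplicity
import Mathlib.NumberTheory.Padics.PadicVal.Basic
import Mathlib.RingTheory.RootsOfUnity.PrimitiveRoots
import Mathlib.Algebra.Ring.GeomSum
import Mathlib.Data.Nat.Factorization.Basic
import HarnessLib

/-!
# Finite-field inputs for the torus at a split multiplicative place over an unramified layer:
# `n`-th roots in `𝔽_{q^f}` of elements of `𝔽_q` when `n ∣ f`, and the norm `μ_{q^f-1} → μ_{q-1}`

`Proofs` file (theorems only, no definitions, no named facts) in topic
`NumberTheory/EllipticCurves`; first bottom-up step of the arithmetic half of the named fact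
`Literature.Barriers.BirchSwinnertonDyer.Matsuno2009_lemma41_local` (K. Matsuno, *Elliptic
curves with large Tate–Shafarevich groups over a number field*, Math. Res. Lett. **16** (2009),
Lemma 4.1, p. 454: for `E/ℚ_ℓ` split multiplicative, `L/ℚ_ℓ` unramified of degree `f` with
`n ∣ f`, `n ∣ c_ℓ`, `ℓ ∤ n`, the group `H¹(Gal(L/ℚ_ℓ), E(L))` has an element of order `n`), whose
group-cohomological half is `DescentDefectUnboundedMatsunoLemma41CyclicProofs`
(`Matsuno2009.nRankAtLeast_unramifiedH1_of_sum_eq_zero`: it remains to produce a norm-zero point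
of `E(L)` with a component of order divisible by `n`).  In the proof of that arithmetic half
through the reduction onto the split torus `E₀(L)/E₁(L) ≅ k_L^× = 𝔽_{q^f}^×` (Silverman, *AEC*,
VII.2.1 with III.2.5 and Ex. 3.5; the tree's `NodeReductionMapProofs`), on which the Frobenius
acts as `x ↦ x^q`, two facts about the cyclic group `𝔽_{q^f}^× = μ_{q^f-1}` are used, and this
file proves them for any integral domain containing a primitive `(q^f - 1)`-th root of unity `ζ`
(in the application: the algebraic closure of the residue field, `ζ` the residue of a
Teichmüller root of unity of the layer):

* `exists_pow_eq_and_pow_pow_eq` — **if `n ∣ f`, every `t` with `t^q = t` (an element of `𝔽_q`)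
  is an `n`-th power `t = s^n` of some `s` with `s^{q^f} = s` (an element of `𝔽_{q^f}`)**.  In
  the cyclic group `μ_{q^f-1} = ⟨ζ⟩` this is the divisibility
  `(q - 1) · gcd(n, q^f - 1) ∣ q^f - 1` (`sub_one_mul_gcd_dvd_pow_sub_one`), proved prime by
  prime with the lifting-the-exponent lemma (Mathlib `padicValNat.pow_sub_pow`,
  `padicValNat.pow_two_sub_one`): for an odd prime `p ∣ q - 1`,
  `v_p(q^f - 1) = v_p(q - 1) + v_p(f) ≥ v_p(q - 1) + v_p(n)`; for `p = 2 ∣ q - 1` and `f` even,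
  `v_2(q^f - 1) = v_2(q + 1) + v_2(q - 1) + v_2(f) - 1 ≥ v_2(q - 1) + v_2(n)`, while for `f` odd
  `n` is odd.  (For the Tate curve `E_q = 𝔾_m/q^ℤ` this is the statement that the unit part of
  the Tate parameter acquires an `n`-th root in the unramified extension of degree `f`.)
* `exists_pow_eq_one_and_prod_pow_pow_eq` — **the norm `N(u) = ∏_{j<f} u^{q^j} =
  u^{(q^f-1)/(q-1)}` maps `μ_{q^f-1}` onto `μ_{q-1}`**: every `t ≠ 0` with `t^q = t` is `N(u)`
  for some `u` with `u^{q^f-1} = 1` (surjectivity of the norm of `𝔽_{q^f}/𝔽_q`; Serre, *Local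
  Fields*, V §2, the unramified case, on the residue fields).

Everything here is elementary and self-contained (finite cyclic groups); no Weierstrass curve
appears.

## References

* [Matsuno2009] K. Matsuno, Math. Res. Lett. 16 (2009), no. 3, 449–461, Lemma 4.1 (p. 454).
* [SerreLocalFields1979] J.-P. Serre, *Local Fields*, GTM 67 (1979), IV §4 Prop. 16, V §2.
* [SilvermanAEC2009] J. H. Silverman, *The Arithmetic of Elliptic Curves*, 2nd ed. (2009),
  Prop. III.2.5, Exercise 3.5, Prop. VII.2.1, VII.5.

## Design

No definitions; plain `theorem`s in `namespace Literature.NumberTheory.EllipticCurves`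
(sub-namespace `TorusNorm` to keep the short names unambiguous).  §1 is pure arithmetic in `ℕ`;
§2 works in a commutative ring without zero divisors `M₀` with `ζ : M₀`,
`IsPrimitiveRoot ζ (q ^ f - 1)` and `0 < q ^ f - 1` (which forces `2 ≤ q`, `f ≠ 0`).
-/

namespace Literature.NumberTheory.EllipticCurves.TorusNorm

open Finset

/-! ### §1 Arithmetic: `(q - 1) · gcd(n, q^f - 1) ∣ q^f - 1` for `n ∣ f` -/

/-- **Prime-by-prime form** (lifting the exponent): for a prime `p`, `2 ≤ q`, `f ≠ 0` and
`n ∣ f`, `v_p(q - 1) + v_p(gcd(n, q^f - 1)) ≤ v_p(q^f - 1)`. [folklore] -/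
theorem padicValNat_sub_one_add_gcd_le (p : ℕ) [hp : Fact p.Prime] {q n f : ℕ} (hq : 2 ≤ q)
    (hf : f ≠ 0) (hnf : n ∣ f) :
    padicValNat p (q - 1) + padicValNat p (Nat.gcd n (q ^ f - 1)) ≤
      padicValNat p (q ^ f - 1) := by
  have hn0 : n ≠ 0 := by rintro rfl; exact hf (zero_dvd_iff.mp hnf)
  have hM0 : q ^ f - 1 ≠ 0 := by
    have : 1 < q ^ f := Nat.one_lt_pow hf (by omega)
    omega
  set M := q ^ f - 1 with hMdef
  have hg0 : Nat.gcd n M ≠ 0 := fun h ↦ hn0 (Nat.eq_zero_of_gcd_eq_zero_left h)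
  -- `v_p(gcd) ≤ v_p(n) ≤ v_p(f)`, `v_p(gcd) ≤ v_p(M)`, `v_p(q - 1) ≤ v_p(M)`
  have hgn : padicValNat p (Nat.gcd n M) ≤ padicValNat p n :=
    (padicValNat_dvd_iff_le hn0).mp (pow_padicValNat_dvd.trans (Nat.gcd_dvd_left n M))
  have hgM : padicValNat p (Nat.gcd n M) ≤ padicValNat p M :=
    (padicValNat_dvd_iff_le hM0).mp (pow_padicValNat_dvd.trans (Nat.gcd_dvd_right n M))
  have hnf' : padicValNat p n ≤ padicValNat p f :=
    (padicValNat_dvd_iff_le hf).mp (pow_padicValNat_dvd.trans hnf)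
  have hdvdM : q - 1 ∣ M := Nat.sub_one_dvd_pow_sub_one q f
  have hdM : padicValNat p (q - 1) ≤ padicValNat p M :=
    (padicValNat_dvd_iff_le hM0).mp (pow_padicValNat_dvd.trans hdvdM)
  by_cases hpd : p ∣ q - 1
  · have hpq : ¬ p ∣ q := fun h ↦ by
      have h1 : p ∣ q - (q - 1) := Nat.dvd_sub h hpd
      rw [show q - (q - 1) = 1 by omega, Nat.dvd_one] at h1
      exact hp.out.one_lt.ne' h1
    rcases hp.out.eq_two_or_odd' with rfl | hodd
    · -- `p = 2`, `q` odd
      rcases Nat.even_or_odd f with hfe | hfo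
      · have h := padicValNat.pow_two_sub_one (x := q) (n := f) (by omega) hpq hf hfe
        rw [← hMdef] at h
        have h2 : 1 ≤ padicValNat 2 (q + 1) :=
          one_le_padicValNat_of_dvd (by omega) (by omega)
        omega
      · -- `f` odd, hence `n` and `gcd(n, M)` are odd
        have hno : ¬ 2 ∣ Nat.gcd n M := fun h2 ↦
          hfo.not_two_dvd_nat ((h2.trans (Nat.gcd_dvd_left n M)).trans hnf)
        rw [padicValNat.eq_zero_of_not_dvd hno, add_zero]
        exact hdM
    · -- `p` odd: `v_p(q^f - 1) = v_p(q - 1) + v_p(f)`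
      have h := padicValNat.pow_sub_pow (p := p) hodd (x := q) (y := 1) (by omega) hpd hpq hf
      rw [one_pow, ← hMdef] at h
      omega
  · rw [padicValNat.eq_zero_of_not_dvd hpd, zero_add]
    exact hgM

/-- **`(q - 1) · gcd(n, q^f - 1)` divides `q^f - 1` whenever `n ∣ f`** (all natural numbers;
the degenerate cases `f = 0`, `q ≤ 1` are trivial).  Equivalently: in a cyclic group of order
`q^f - 1`, the subgroup of order `q - 1` consists of `n`-th powers. [folklore] -/
theorem sub_one_mul_gcd_dvd_pow_sub_one {q n f : ℕ} (hnf : n ∣ f) :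
    (q - 1) * Nat.gcd n (q ^ f - 1) ∣ q ^ f - 1 := by
  rcases Nat.eq_zero_or_pos f with rfl | hf
  · simp
  rcases Nat.lt_or_ge q 2 with hq | hq
  · interval_cases q
    · rw [Nat.zero_pow hf]; simp
    · simp
  have hn0 : n ≠ 0 := by rintro rfl; exact hf.ne' (zero_dvd_iff.mp hnf)
  have hM0 : q ^ f - 1 ≠ 0 := by
    have : 1 < q ^ f := Nat.one_lt_pow hf.ne' (by omega)
    omega
  have hg0 : Nat.gcd n (q ^ f - 1) ≠ 0 := fun h ↦ hn0 (Nat.eq_zero_of_gcd_eq_zero_left h)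
  have hA0 : (q - 1) * Nat.gcd n (q ^ f - 1) ≠ 0 := mul_ne_zero (by omega) hg0
  refine (Nat.dvd_iff_prime_pow_dvd_dvd _ _).mpr fun p k hpp hpk ↦ ?_
  haveI := Fact.mk hpp
  rw [padicValNat_dvd_iff_le hM0]
  rw [padicValNat_dvd_iff_le hA0, padicValNat.mul (by omega) hg0] at hpk
  exact hpk.trans (padicValNat_sub_one_add_gcd_le p hq hf.ne' hnf)

/-- The geometric sum: `(q - 1) · ((q^f - 1)/(q - 1)) = q^f - 1` and
`∑_{j<f} q^j = (q^f - 1)/(q - 1)` for `2 ≤ q` (Mathlib `Nat.geomSum_eq`). [folklore] -/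
theorem sub_one_mul_div_eq {q : ℕ} (hq : 2 ≤ q) (f : ℕ) :
    (q - 1) * ((q ^ f - 1) / (q - 1)) = q ^ f - 1 := by
  have _ := hq
  exact Nat.mul_div_cancel' (Nat.sub_one_dvd_pow_sub_one q f)

/-! ### §2 Roots of unity: `n`-th roots in `𝔽_{q^f}` and the norm onto `𝔽_q^×` -/

section Roots

variable {M₀ : Type*} [CommRing M₀] {q f : ℕ} {ζ : M₀}

/-- `0 < q^f - 1` forces `2 ≤ q` and `f ≠ 0`. [folklore] -/
theorem two_le_and_ne_zero_of_pow_sub_one_pos (hN : 0 < q ^ f - 1) : 2 ≤ q ∧ f ≠ 0 := by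
  constructor
  · by_contra h
    push Not at h
    interval_cases q
    · rcases Nat.eq_zero_or_pos f with rfl | hf
      · simp at hN
      · rw [Nat.zero_pow hf] at hN; simp at hN
    · simp at hN
  · rintro rfl
    simp at hN

/-- An element of "`𝔽_q`" is a `(q - 1)`-th root of unity: `t^q = t`, `t ≠ 0` give
`t^{q-1} = 1` (for `1 ≤ q`). [folklore] -/
theorem pow_sub_one_eq_one_of_pow_eq [IsDomain M₀] (hq : 1 ≤ q) {t : M₀} (ht : t ^ q = t)
    (ht0 : t ≠ 0) :
    t ^ (q - 1) = 1 := by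
  have h : t ^ (q - 1) * t = 1 * t := by
    rw [← pow_succ, Nat.sub_add_cancel hq, ht, one_mul]
  exact mul_right_cancel₀ ht0 h

/-- Conversely `u^{q^f - 1} = 1` gives `u^{q^f} = u` (for `0 < q^f - 1`). [folklore] -/
theorem pow_pow_eq_self_of_pow_sub_one_eq_one (hN : 0 < q ^ f - 1) {u : M₀}
    (hu : u ^ (q ^ f - 1) = 1) : u ^ q ^ f = u := by
  have h1 : 1 ≤ q ^ f := by omega
  conv_lhs => rw [← Nat.sub_add_cancel h1, pow_succ, hu, one_mul]

/-- **The `(q-1)`-th roots of unity are the powers of `ζ^{(q^f-1)/(q-1)}`**, `ζ` a primitive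
`(q^f - 1)`-th root of unity in a domain. [folklore] -/
theorem exists_pow_mul_eq_of_pow_sub_one_eq_one [IsDomain M₀] (hζ : IsPrimitiveRoot ζ (q ^ f - 1))
    (hN : 0 < q ^ f - 1) {t : M₀} (ht : t ^ (q - 1) = 1) :
    ∃ a : ℕ, ζ ^ ((q ^ f - 1) / (q - 1) * a) = t := by
  obtain ⟨hq, -⟩ := two_le_and_ne_zero_of_pow_sub_one_pos hN
  have hd0 : q - 1 ≠ 0 := by omega
  haveI : NeZero (q - 1) := ⟨hd0⟩
  have hprod : q ^ f - 1 = (q ^ f - 1) / (q - 1) * (q - 1) := by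
    rw [mul_comm, sub_one_mul_div_eq hq]
  have hη : IsPrimitiveRoot (ζ ^ ((q ^ f - 1) / (q - 1))) (q - 1) := hζ.pow hN hprod
  obtain ⟨a, -, ha⟩ := hη.eq_pow_of_pow_eq_one ht
  exact ⟨a, by rw [pow_mul, ha]⟩

/-- **`n`-th roots in `𝔽_{q^f}` of elements of `𝔽_q` when `n ∣ f`.**  In a domain containing a
primitive `(q^f - 1)`-th root of unity (e.g. an algebraic closure of `𝔽_q`), if `n ∣ f` then
every `t` with `t^q = t` is `s^n` for some `s` with `s^{q^f} = s`: by
`sub_one_mul_gcd_dvd_pow_sub_one`, `t = ζ^{(q^f-1)/(q-1)·a}` is a power of `ζ^{gcd(n, q^f-1)}`,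
which is an `n`-th power by Bézout.  (For `E/ℚ_ℓ` split multiplicative with Tate parameter of
unit part `α`: `α` becomes an `n`-th power in the unramified extension of degree `f`; this is
what makes the bad component of order `n` contain an `n`-torsion point over that extension.)
[cite: SerreLocalFields1979, IV §4 Prop. 16 (μ_{q^f-1} ⊆ the unramified extension of degree f)] -/
theorem exists_pow_eq_and_pow_pow_eq [IsDomain M₀] (hζ : IsPrimitiveRoot ζ (q ^ f - 1))
    (hN : 0 < q ^ f - 1) {n : ℕ} (hnf : n ∣ f) {t : M₀} (ht : t ^ q = t) :
    ∃ s : M₀, s ^ n = t ∧ s ^ q ^ f = s := by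
  obtain ⟨hq, hf⟩ := two_le_and_ne_zero_of_pow_sub_one_pos hN
  have hn0 : n ≠ 0 := by rintro rfl; exact hf (zero_dvd_iff.mp hnf)
  have hqf0 : q ^ f ≠ 0 := pow_ne_zero _ (by omega)
  by_cases ht0 : t = 0
  · exact ⟨0, by rw [ht0, zero_pow hn0], by rw [zero_pow hqf0]⟩
  -- `t = ζ^{((q^f-1)/(q-1)) a}`
  obtain ⟨a, ha⟩ := exists_pow_mul_eq_of_pow_sub_one_eq_one hζ hN
    (pow_sub_one_eq_one_of_pow_eq (by omega) ht ht0)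
  -- `(q - 1) g ∣ q^f - 1`, `g = gcd(n, q^f - 1)`, so `(q^f-1)/(q-1) = g c`
  obtain ⟨c, hc⟩ : Nat.gcd n (q ^ f - 1) ∣ (q ^ f - 1) / (q - 1) := by
    obtain ⟨e, he⟩ := sub_one_mul_gcd_dvd_pow_sub_one (q := q) hnf
    refine ⟨e, ?_⟩
    have hd0 : 0 < q - 1 := by omega
    apply Nat.eq_of_mul_eq_mul_left hd0
    rw [sub_one_mul_div_eq hq, ← mul_assoc]
    exact he
  -- Bézout: `n x ≡ g (mod q^f - 1)`
  obtain ⟨x, hx⟩ : ∃ x : ℕ, n * x % (q ^ f - 1) = Nat.gcd n (q ^ f - 1) % (q ^ f - 1) := by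
    by_cases hlt : Nat.gcd n (q ^ f - 1) < q ^ f - 1
    · obtain ⟨x, -, hx⟩ := Nat.exists_mul_mod_eq_gcd hlt
      exact ⟨x, by rw [hx, Nat.mod_eq_of_lt hlt]⟩
    · -- `gcd(n, q^f - 1) = q^f - 1`
      have hle : Nat.gcd n (q ^ f - 1) ≤ q ^ f - 1 :=
        Nat.le_of_dvd hN (Nat.gcd_dvd_right n (q ^ f - 1))
      have heq : Nat.gcd n (q ^ f - 1) = q ^ f - 1 := le_antisymm hle (not_lt.mp hlt)
      refine ⟨0, ?_⟩
      rw [mul_zero, heq, Nat.zero_mod, Nat.mod_self]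
  have hζN : ζ ^ (q ^ f - 1) = 1 := hζ.pow_eq_one
  have hpowmod : ∀ m : ℕ, ζ ^ m = ζ ^ (m % (q ^ f - 1)) := fun m ↦ by
    conv_lhs => rw [← Nat.mod_add_div m (q ^ f - 1), pow_add, pow_mul, hζN, one_pow, mul_one]
  refine ⟨ζ ^ (x * (c * a)), ?_, ?_⟩
  · rw [← pow_mul, show x * (c * a) * n = n * x * (c * a) by ring, pow_mul, hpowmod (n * x), hx,
      ← hpowmod, ← pow_mul, ← mul_assoc, ← hc, ha]
  · apply pow_pow_eq_self_of_pow_sub_one_eq_one hN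
    rw [← pow_mul, mul_comm, pow_mul, hζN, one_pow]

/-- **The norm `μ_{q^f-1} → μ_{q-1}` is onto**: every `t ≠ 0` with `t^q = t` is `u^{(q^f-1)/(q-1)}`
for some `u` with `u^{q^f-1} = 1`. [cite: SerreLocalFields1979, V §2 (norm in the unramified case)] -/
theorem exists_pow_eq_one_and_pow_div_eq [IsDomain M₀] (hζ : IsPrimitiveRoot ζ (q ^ f - 1))
    (hN : 0 < q ^ f - 1) {t : M₀} (ht : t ^ q = t) (ht0 : t ≠ 0) :
    ∃ u : M₀, u ^ (q ^ f - 1) = 1 ∧ u ^ ((q ^ f - 1) / (q - 1)) = t := by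
  obtain ⟨hq, -⟩ := two_le_and_ne_zero_of_pow_sub_one_pos hN
  obtain ⟨a, ha⟩ := exists_pow_mul_eq_of_pow_sub_one_eq_one hζ hN
    (pow_sub_one_eq_one_of_pow_eq (by omega) ht ht0)
  refine ⟨ζ ^ a, ?_, ?_⟩
  · rw [← pow_mul, mul_comm, pow_mul, hζ.pow_eq_one, one_pow]
  · rw [← pow_mul, mul_comm, ha]

/-- The Frobenius-norm of the layer on the torus: `∏_{j<f} u^{q^j} = u^{(q^f-1)/(q-1)}` (`2 ≤ q`).
[folklore] -/
theorem prod_pow_pow_eq_pow_div {R : Type*} [CommMonoid R] (hq : 2 ≤ q) (f : ℕ) (u : R) :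
    ∏ j ∈ range f, u ^ q ^ j = u ^ ((q ^ f - 1) / (q - 1)) := by
  rw [prod_pow_eq_pow_sum, Nat.geomSum_eq hq]

/-- **Norm-surjectivity in the form used for norm-zero points**: every `t ≠ 0` with `t^q = t` is
`∏_{j<f} u^{q^j}` for some `u` with `u^{q^f-1} = 1` (so `u^{q^f} = u`). In the application `u`
is the torus value of a prime-to-`ℓ` torsion point `Q` of `E₀(L)` and `∏_{j<f} u^{q^j}` that of
`Σ_{j<f} Fʲ Q`, `F` the Frobenius. [cite: SerreLocalFields1979, V §2] -/
theorem exists_pow_eq_one_and_prod_pow_pow_eq [IsDomain M₀] (hζ : IsPrimitiveRoot ζ (q ^ f - 1))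
    (hN : 0 < q ^ f - 1) {t : M₀} (ht : t ^ q = t) (ht0 : t ≠ 0) :
    ∃ u : M₀, u ^ (q ^ f - 1) = 1 ∧ u ^ q ^ f = u ∧ ∏ j ∈ range f, u ^ q ^ j = t := by
  obtain ⟨hq, -⟩ := two_le_and_ne_zero_of_pow_sub_one_pos hN
  obtain ⟨u, hu1, hut⟩ := exists_pow_eq_one_and_pow_div_eq hζ hN ht ht0
  exact ⟨u, hu1, pow_pow_eq_self_of_pow_sub_one_eq_one hN hu1,
    by rw [prod_pow_pow_eq_pow_div hq, hut]⟩

/-- Elements of "`𝔽_{q^f}`" are closed under products and powers: if `u^{q^f} = u` then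
`(u^m)^{q^f} = u^m`. [folklore] -/
theorem pow_pow_pow_eq_of_pow_pow_eq {R : Type*} [CommMonoid R] {u : R} (hu : u ^ q ^ f = u)
    (m : ℕ) : (u ^ m) ^ q ^ f = u ^ m := by
  rw [← pow_mul, mul_comm, pow_mul, hu]

end Roots

end Literature.NumberTheory.EllipticCurves.TorusNorm
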